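import Mathlib
import HarnessLib
import Summits.Langlands.Langlands.Theses.QuarterDeficit1951

/-!
# Line `ParityPurePoint` (alt line, crux-strategist s1) — crux stmt-Langlands-15897
`Summit.Langlands.Langlands.Theses.QuarterDeficit1951.QuarterFingerprintDeficit` (C1)

REFUTATION-FIRST line (like the live line `Sketch`): the composition concludes `¬ QuarterFingerprintDeficit`.
C1 is numerically FALSE (lead c0's Hejhal `r = 0` sighting: ODD `λ = 1/4` newforms for all four order-5 `χ`,
Cruxes/QuarterFingerprintDeficit/SightingHejhalR0.md); what remains is a CERTIFICATE (verdict class computation).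
Companion PROOF-direction skeleton (the parity DECOMPOSITION `DeficitOdd → DeficitEven → C1`, which is what the
skeleton audit registers): `Lines/ParitySplit.lean`.

LEVER (transfer of the level-1 parity remark to `(Γ₀(1951), χ)`): an order-5 character mod 1951 is EVEN and
1951 is PRIME, so the Eisenstein series of `(Γ₀(1951), χ)` are exactly `E_∞ = E_{1,χ}` and `E_0 = E_{χ,1}`
(Young 2019), and BOTH are invariant under the reflection `R : z ↦ -z̄` (Mathlib: `UpperHalfPlane.J • z`):
reindex `(c, d) ↦ (c, -d)` and use `χ(-1) = 1` (stub `stub_eisenstein_even`); `R` commutes with the Fricke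
involution (`J_smul_W1951_smul`, proved). Hence the `R`-ODD part of `L²(Γ₀(1951)\ℍ, χ)` has NO continuous (and no
residual) spectrum: it is spanned by odd Maass CUSP forms. The predicted/sighted Doud–Moore forms are odd.
Consequences for the certificate:
(i) NO Eisenstein annihilator is needed (Child 2022 Def. 3.1 `♦ = ∏_ψ (T_m − Σ ψ(a/b)χ(b)(b/a)^{√(1/4−Δ)})`,
BSV 2006's `ℵ`, the lead's local product `(T₂ − U − χ(2)U*)(T₂ − χ(2)U − U*)`): for the odd quasimode
`g = f̃_S` (odd by construction from an `R`-symmetric pullback domain) Child's Lemma 4 applies verbatim inside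
`L²_odd = L²_odd,cusp`, and the joint Hecke boxes come from the LANDED abstract stub
`Theorems.QuarterFingerprintDeficit.stub_jointQuasimodePigeonhole` (p128255) with `b` = an orthonormal basis of
odd Hecke–Maass cusp forms (a genuine `HilbertBasis` of the odd sector — which the full `L²` does not have);
(ii) odd + automorphic ⇒ BOTH constant-term clauses of the crux's `IsForm` hold identically
(`stub_oddConstantTerms`, kernel-provable and LOAD-BEARING in the composition), so the computational stub need
not certify cuspidality clauses at all; (iii) the decisive stub is RE-CUT to what a ball-arithmetic certificate
literally delivers — an odd form with `|λ − 1/4| ≤ 1/100` and Hecke eigenvalues in boxes of radius `r_p` around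
EXACT centres `a_p ∈ ℤ[ζ₅]` with `a_p² χ̄(p) ∈ Φ` and `r_p (2|a_p| + r_p) ≤ 1/100` (so `r = 1/10` at `p = 5, 7`
where `a_p = 0`; `1/250` at `p = 2, 13`; `1/150` at `p = 3, 11`) — instead of the EXACT `λ = 1/4`, exact-fingerprint
hypothesis `EvenIcosahedralMaassFormAt1951` of line `Sketch`, which no finite computation can establish
(Booker, Exp. Math. 15 (2006) §1).

Stubs (signatures self-contained over Mathlib + Literature, registered on the item): P1 `stub_oddConstantTerms`
(Lean, M; used in the composition) · P2a `stub_reflect_laplacian` (Lean, M: `IsC2`/`hypLaplacian` transport under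
`J`) · P2b `stub_reflect_automorphy_hecke` (Lean, M: automorphy with the SAME character and the crux's `T_p` commute
with `J`) · P3 `stub_eisenstein_even` (Lean, M: `tsum` reindexing, unconditional in `s`) · P4
`stub_oddWindowCertificate` (DECISIVE, computational: Arb certificate at `(1951, χ₁)`, odd sector). Composition
`not_QuarterFingerprintDeficit_of : P1 → P4 → ¬ C1` is sorry-free below.
Disproof used: honours `quarterFingerprintDeficit_false_without_nonzero` (the witness carries `∃ z, u z ≠ 0`);
consistent with `not_deficit_iff_windowSighting` (P1 ∧ P4 produce exactly a `WindowSighting`).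
-/

set_option linter.dupNamespace false

noncomputable section

namespace Summit.Langlands.Langlands.Cruxes.QuarterFingerprintDeficit.ParityPurePoint

open Summit.Langlands.Langlands.Theses.QuarterDeficit1951
open scoped BigOperators ComplexConjugate MatrixGroups
open UpperHalfPlane (J ofComplex)

/-! ## 0. The crux's inlined `let`s, named (verbatim copies; used only by P4 and the composition) -/

/-- `Φ = {0, 1, 4, (3 ± √5)/2}` — projective fingerprint values `tr²/det` at elements of order 1,2,3,5. [folklore] -/
def Φ : Set ℂ := {0, 1, 4, (((3 + Real.sqrt 5) / 2 : ℝ) : ℂ), (((3 - Real.sqrt 5) / 2 : ℝ) : ℂ)}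

/-- The six fingerprint primes. [folklore] -/
def P₀ : Finset ℕ := {2, 3, 5, 7, 11, 13}

/-- The crux's automorphy clause: `u (γ z) = χ(d_γ) u z` on `Γ₀(1951)`. [folklore] -/
def IsAutomorphicChi (χ : DirichletCharacter ℂ 1951) (u : UpperHalfPlane → ℂ) : Prop :=
  ∀ γ : Matrix.SpecialLinearGroup (Fin 2) ℤ, γ ∈ CongruenceSubgroup.Gamma0 1951 →
    ∀ z : UpperHalfPlane, u (γ • z) = χ ((γ 1 1 : ℤ) : ZMod 1951) * u z

/-- The crux's classical Hecke operator (unitary normalisation, nebentypus `χ`). [folklore] -/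
def Tp (χ : DirichletCharacter ℂ 1951) (p : ℕ) (u : UpperHalfPlane → ℂ) (z : UpperHalfPlane) : ℂ :=
  ((Real.sqrt p : ℝ) : ℂ)⁻¹ *
    ((∑ b ∈ Finset.range p, u (ofComplex (((z : ℂ) + b) / p))) +
      χ (p : ZMod 1951) * u (ofComplex ((p : ℂ) * z)))

/-- ODD under the reflection `R : z ↦ -z̄` (Mathlib's `UpperHalfPlane.J • z`, `coe_J_smul`). [folklore] -/
def IsOdd (u : UpperHalfPlane → ℂ) : Prop := ∀ z : UpperHalfPlane, u (J • z) = - u z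

/-! ## 1. Stubs (statements written out over Mathlib + Literature only, so `propose --supports` can match them) -/

/-- STUB P1 (Lean, M; LOAD-BEARING in the composition): an odd `Γ₀(1951)`-automorphic function has vanishing
constant terms at BOTH cusps, identically in `y`: `∫₀¹ u(x+iy) dx = 0` (use `u(z+1) = u(z)` from `T ∈ Γ₀(1951)`,
`χ(1) = 1`, then `x ↦ -x`) and `∫₀^{1951} u(S•(x+iy)) dx = 0` (`S T^{1951} S⁻¹ = [[1,0],[-1951,1]] ∈ Γ₀(1951)`
gives period 1951; `S•(R w) = R (S•w)` gives oddness of `x ↦ u(S•(x+iy))`). No integrability is needed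
(`intervalIntegral.integral_comp_neg` / `integral_comp_add_right` are unconditional). [folklore] -/
theorem stub_oddConstantTerms (χ : DirichletCharacter ℂ 1951) (u : UpperHalfPlane → ℂ)
    (haut : ∀ γ : Matrix.SpecialLinearGroup (Fin 2) ℤ, γ ∈ CongruenceSubgroup.Gamma0 1951 →
      ∀ z : UpperHalfPlane, u (γ • z) = χ ((γ 1 1 : ℤ) : ZMod 1951) * u z)
    (hodd : ∀ z : UpperHalfPlane, u (UpperHalfPlane.J • z) = - u z) :
    (∀ y : ℝ, 0 < y → ∫ x in (0 : ℝ)..1, u (UpperHalfPlane.ofComplex (x + y * Complex.I)) = 0) ∧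
    (∀ y : ℝ, 0 < y →
      ∫ x in (0 : ℝ)..1951, u (ModularGroup.S • UpperHalfPlane.ofComplex (x + y * Complex.I)) = 0) := by
  sorry

/-- STUB P2a (Lean, M): the crux's regularity and Laplacian clauses transport under the reflection:
`u ∘ R` is `C²` on the open upper half-plane when `u` is, and `Δ(u ∘ R) = (Δ u) ∘ R` (the Euclidean Laplacian
is invariant under the linear isometry `w ↦ -w̄`, and `Im (R z) = Im z`). [folklore] -/
theorem stub_reflect_laplacian (u : UpperHalfPlane → ℂ) (hu : Literature.NumberTheory.Automorphic.IsC2 u) :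
    Literature.NumberTheory.Automorphic.IsC2 (fun z => u (UpperHalfPlane.J • z)) ∧
    ∀ z : UpperHalfPlane,
      Literature.NumberTheory.Automorphic.hypLaplacian (fun w => u (UpperHalfPlane.J • w)) z =
      Literature.NumberTheory.Automorphic.hypLaplacian u (UpperHalfPlane.J • z) := by
  sorry

/-- STUB P2b (Lean, M): automorphy with the SAME character transports under `R`
(`R γ R = [[a,-b],[-c,d]] ∈ Γ₀(1951)` has the same `d`), and the crux's `T_p` commutes with `R` for the six
fingerprint primes (`-conj((z+b)/p) = (Rz - b)/p ≡ (Rz + (p-b))/p` mod the period `1`, reindex `b ↦ p - b`).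
So the odd sector is `T_p`-stable and the crux's witness class is `R`-stable. [folklore] -/
theorem stub_reflect_automorphy_hecke (χ : DirichletCharacter ℂ 1951) (u : UpperHalfPlane → ℂ)
    (haut : ∀ γ : Matrix.SpecialLinearGroup (Fin 2) ℤ, γ ∈ CongruenceSubgroup.Gamma0 1951 →
      ∀ z : UpperHalfPlane, u (γ • z) = χ ((γ 1 1 : ℤ) : ZMod 1951) * u z) :
    (∀ γ : Matrix.SpecialLinearGroup (Fin 2) ℤ, γ ∈ CongruenceSubgroup.Gamma0 1951 →
      ∀ z : UpperHalfPlane, u (UpperHalfPlane.J • (γ • z)) = χ ((γ 1 1 : ℤ) : ZMod 1951) * u (UpperHalfPlane.J • z)) ∧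
    ∀ p ∈ ({2, 3, 5, 7, 11, 13} : Finset ℕ), ∀ z : UpperHalfPlane,
      ((Real.sqrt p : ℝ) : ℂ)⁻¹ *
        ((∑ b ∈ Finset.range p, u (UpperHalfPlane.J • UpperHalfPlane.ofComplex (((z : ℂ) + b) / p))) +
          χ (p : ZMod 1951) * u (UpperHalfPlane.J • UpperHalfPlane.ofComplex ((p : ℂ) * z))) =
      ((Real.sqrt p : ℝ) : ℂ)⁻¹ *
        ((∑ b ∈ Finset.range p, u (UpperHalfPlane.ofComplex (((↑(UpperHalfPlane.J • z) : ℂ) + b) / p))) +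
          χ (p : ZMod 1951) * u (UpperHalfPlane.ofComplex ((p : ℂ) * ↑(UpperHalfPlane.J • z)))) := by
  sorry

/-- STUB P3 (Lean, M): for an EVEN Dirichlet character the weight-0 Eisenstein series of `(Γ₀(N), χ)` at `∞`,
`E(z, s, χ) = Σ_{(c,d)=1, N ∣ c} χ(d)⁻¹ yˢ/|cz+d|^{2s}` (as a `tsum`; both signs of `(c,d)`, no `1/2`), is EVEN
under `R : z ↦ -z̄` (`|c(-z̄) + d| = |cz - d|`, reindex `(c,d) ↦ (c,-d)`, `χ(-d) = χ(d)`); true for every real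
`s` as a `tsum` identity (`Equiv.tsum_eq`, no summability needed). At PRIME level with `χ ≠ 1` the only other
Eisenstein series is the Fricke transform of `E(·, s, χ̄)`, and `R` commutes with Fricke (`J_smul_W1951_smul`),
so the whole continuous spectrum of `(Γ₀(1951), χ)` is `R`-even and `L²_odd` is purely cuspidal (paper side of
P4). [folklore] -/
theorem stub_eisenstein_even (N : ℕ) (χ : DirichletCharacter ℂ N) (hχ : χ (-1) = 1) (s : ℝ)
    (z : UpperHalfPlane) :
    (∑' v : {v : Fin 2 → ℤ // IsCoprime (v 0) (v 1) ∧ (N : ℤ) ∣ v 0},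
      (χ ((v.1 1 : ℤ) : ZMod N))⁻¹ *
        (((UpperHalfPlane.im (UpperHalfPlane.J • z)) ^ s /
          ‖((v.1 0 : ℤ) : ℂ) * ((↑(UpperHalfPlane.J • z)) : ℂ) + ((v.1 1 : ℤ) : ℂ)‖ ^ (2 * s) : ℝ) : ℂ)) =
    ∑' v : {v : Fin 2 → ℤ // IsCoprime (v 0) (v 1) ∧ (N : ℤ) ∣ v 0},
      (χ ((v.1 1 : ℤ) : ZMod N))⁻¹ *
        (((UpperHalfPlane.im z) ^ s / ‖((v.1 0 : ℤ) : ℂ) * (z : ℂ) + ((v.1 1 : ℤ) : ℂ)‖ ^ (2 * s) : ℝ) : ℂ) := by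
  sorry

/-- The PARITY-SECTOR WINDOW CERTIFICATE at conductor 1951 — the literal output of a ball-arithmetic
BSV/Child-type quasimode certificate run in the ODD sector (no Eisenstein annihilator): an order-5 `χ`, an odd
bounded `C²` `Γ₀(1951)`-automorphic eigenfunction `u ≢ 0` with `|λ − 1/4| ≤ 1/100`, joint `T_p`-eigen for
`p ≤ 13` with eigenvalues in boxes `‖μ_p − a_p‖ ≤ r_p` around EXACT centres `a_p` (`a_p² χ̄(p) ∈ Φ`, in practice
`a_p ∈ ℤ[ζ₅]` from the Doud–Moore `A₅` field) of radii with `r_p (2‖a_p‖ + r_p) ≤ 1/100`. NO constant-term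
clauses (they follow in-kernel from oddness, P1). Decided by computation (verdict class `computation`); not
provable in-kernel today. [folklore] -/
def OddWindowCertificate : Prop :=
  ∃ χ : DirichletCharacter ℂ 1951, orderOf χ = 5 ∧ ∃ (u : UpperHalfPlane → ℂ) (lam : ℝ),
    Literature.NumberTheory.Automorphic.IsC2 u ∧
    (∀ z, Literature.NumberTheory.Automorphic.hypLaplacian u z + (lam : ℂ) * u z = 0) ∧
    IsAutomorphicChi χ u ∧ (∃ C : ℝ, ∀ z, ‖u z‖ ≤ C) ∧ IsOdd u ∧ (∃ z, u z ≠ 0) ∧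
    |lam - 1 / 4| ≤ 1 / 100 ∧
    ∀ p ∈ P₀, ∃ (μ a : ℂ) (r : ℝ), a ^ 2 * conj (χ (p : ZMod 1951)) ∈ Φ ∧ 0 ≤ r ∧
      r * (2 * ‖a‖ + r) ≤ 1 / 100 ∧ (∀ z, Tp χ p u z = μ * u z) ∧ ‖μ - a‖ ≤ r

/-- STUB P4 (DECISIVE, computational — strategist/lead; NOT a proving task): the odd-sector window certificate at
`(1951, χ₁)`. Inputs already on the item: exact trial vector `a_p ∈ ℤ[ζ₅]`, `p ≤ 21000`
(`exact-ap-1951-chi1-odd.tsv`), odd parity. Never provable in-kernel without the spectral theory of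
`L²(Γ₀(N)\ℍ, χ)`. -/
theorem stub_oddWindowCertificate : OddWindowCertificate := by
  sorry

/-! ## 2. Glue (proved) and the composition -/

/-- The Fricke involution `W = [[0,-1],[1951,0]]` of level 1951 as an element of `GL₂(ℝ)` (it swaps the cusps
`∞` and `0` of `Γ₀(1951)` and carries `E_∞(·, s, χ̄)` to `E_0(·, s, χ)`). [folklore] -/
def W1951 : GL (Fin 2) ℝ := .mkOfDetNeZero !![0, -1; 1951, 0] (by norm_num [Matrix.det_fin_two_of])

/-- The reflection commutes with the Fricke involution on `ℍ`: `R(W z) = W(R z) = 1/(1951 z̄)`. Hence the cusp-`0`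
Eisenstein family is `R`-even as soon as the cusp-`∞` family of `χ̄` is (P3). [folklore] -/
theorem J_smul_W1951_smul (z : UpperHalfPlane) : J • (W1951 • z) = W1951 • (J • z) := by
  have hdet : 0 < (W1951).det.val := by
    simp [W1951, Matrix.GeneralLinearGroup.val_det_apply, Matrix.det_fin_two_of]
  apply UpperHalfPlane.ext
  rw [UpperHalfPlane.coe_J_smul, UpperHalfPlane.coe_smul_of_det_pos hdet,
    UpperHalfPlane.coe_smul_of_det_pos hdet, UpperHalfPlane.coe_J_smul]
  simp [UpperHalfPlane.num, UpperHalfPlane.denom, W1951, div_eq_mul_inv, map_ofNat, mul_comm]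

/-- `‖χ(p)‖ = 1` at the six fingerprint primes (they are units mod the prime 1951). [folklore] -/
theorem norm_chi_of_mem_P₀ (χ : DirichletCharacter ℂ 1951) {p : ℕ} (hp : p ∈ P₀) :
    ‖χ (p : ZMod 1951)‖ = 1 := by
  have hcop : Nat.Coprime p 1951 := by
    simp only [P₀, Finset.mem_insert, Finset.mem_singleton] at hp
    rcases hp with rfl | rfl | rfl | rfl | rfl | rfl <;> norm_num
  have h := χ.unit_norm_eq_one (ZMod.unitOfCoprime p hcop)
  rwa [ZMod.coe_unitOfCoprime] at h

/-- BOX ⇒ FINGERPRINT: a box `‖μ − a‖ ≤ r` around a centre `a` with `r (2‖a‖ + r) ≤ 1/100` and a unimodular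
`c` gives `‖μ² c − a² c‖ ≤ 1/100` (`μ²c − a²c = (μ − a)(μ + a) c`). [folklore] -/
theorem box_fingerprint (μ a c : ℂ) (r : ℝ) (hc : ‖c‖ = 1) (hr0 : 0 ≤ r)
    (hr : r * (2 * ‖a‖ + r) ≤ 1 / 100) (hbox : ‖μ - a‖ ≤ r) :
    ‖μ ^ 2 * c - a ^ 2 * c‖ ≤ 1 / 100 := by
  have h1 : μ ^ 2 * c - a ^ 2 * c = (μ - a) * (μ + a) * c := by ring
  have h2 : ‖μ + a‖ ≤ r + 2 * ‖a‖ := by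
    have e : μ + a = (μ - a) + 2 * a := by ring
    calc ‖μ + a‖ = ‖(μ - a) + 2 * a‖ := by rw [← e]
      _ ≤ ‖μ - a‖ + ‖(2 : ℂ) * a‖ := norm_add_le _ _
      _ = ‖μ - a‖ + 2 * ‖a‖ := by rw [norm_mul, Complex.norm_two]
      _ ≤ r + 2 * ‖a‖ := by linarith
  rw [h1, norm_mul, norm_mul, hc, mul_one]
  calc ‖μ - a‖ * ‖μ + a‖ ≤ r * (r + 2 * ‖a‖) :=
        mul_le_mul hbox h2 (norm_nonneg _) hr0
    _ = r * (2 * ‖a‖ + r) := by ring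
    _ ≤ 1 / 100 := hr

/-- COMPOSITION (sorry-free): P1 (odd ⇒ constant terms vanish) and P4 (odd-sector window certificate) give a
witness of exactly the shape `QuarterFingerprintDeficit` forbids — against the route decl BY NAME. -/
theorem not_QuarterFingerprintDeficit_of
    (hP1 : ∀ (χ : DirichletCharacter ℂ 1951) (u : UpperHalfPlane → ℂ), IsAutomorphicChi χ u → IsOdd u →
      (∀ y : ℝ, 0 < y → ∫ x in (0 : ℝ)..1, u (ofComplex (x + y * Complex.I)) = 0) ∧
      (∀ y : ℝ, 0 < y →
        ∫ x in (0 : ℝ)..1951, u (ModularGroup.S • ofComplex (x + y * Complex.I)) = 0))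
    (hP4 : OddWindowCertificate) : ¬ QuarterFingerprintDeficit := by
  intro h₁
  obtain ⟨χ, hχ, u, lam, hC2, hΔ, haut, hbdd, hodd, hne, hwin, hfp⟩ := hP4
  obtain ⟨hct₁, hct₂⟩ := hP1 χ u haut hodd
  refine h₁ χ hχ ⟨u, lam, ⟨hC2, hΔ, haut, hct₁, hct₂, hbdd⟩, hne, hwin, fun p hp => ?_⟩
  obtain ⟨μ, a, r, hφ, hr0, hr, hT, hbox⟩ := hfp p hp
  refine ⟨μ, a ^ 2 * conj (χ (p : ZMod 1951)), hφ, hT, ?_⟩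
  have hc : ‖conj (χ (p : ZMod 1951))‖ = 1 := by
    rw [Complex.norm_conj]; exact norm_chi_of_mem_P₀ χ hp
  exact box_fingerprint μ a _ r hc hr0 hr hbox

/-- The same composition with the stubs plugged in (so the skeleton's conclusion is literally `¬ C1`). -/
theorem not_QuarterFingerprintDeficit : ¬ QuarterFingerprintDeficit :=
  not_QuarterFingerprintDeficit_of stub_oddConstantTerms stub_oddWindowCertificate

end Summit.Langlands.Langlands.Cruxes.QuarterFingerprintDeficit.ParityPurePoint

end
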